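import Summits.CriticalPhenomena.PercolationContinuityZ3.Theorems.PercNearOneGluingNoHeavyLowerTailReduction
import HarnessLib

/-!
# `NoHeavyLowerTail` (stmt-CriticalPhenomena-4575), one-cut line — the one-cut bound WITH A LOGARITHMIC LOSS, all `|A|`

For `μ = prodBernoulli w` on `Fin n`, observer `o`, relay set `A`, `N = |{a ∈ A : o ↔ a}|`, `E N = Σ_a P(o ↔ a)`, and `t`
bounding all pairwise disconnection probabilities among distinct relays:

  `P(1 ≤ N < E N / 2) ≤ (16 ⌈log₂ |A|⌉ + 2) · t`                                   (`oneCut_logLoss`)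

— the sharp engine `stub_oneCut` asks for the constant `1` in place of `16 ⌈log₂|A|⌉ + 2`; `stub_oneCutConst` for any
constant independent of `|A|`.  So the ENTIRE content of the crux on this line is the removal of the factor `log |A|`.
Proof = two tree lemmas: pick a hub `a₀ ∈ A`; on `{o ↔ a₀}` Markov for the number of relays cut from the hub
(`nhlt_hubBlockMarkov`, threshold `E N/2 ≤ |A|/2`) costs `2t`; on `{o ↮ a₀}` the log-scale lower tail
(`nhlt_logScaleLowerTail`, dyadic thinning + single-finger hub lemma, BHK 2006 Thm 1.3) costs `16 t ⌈log₂ |A|⌉`.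
Bookkeeping only.
-/

noncomputable section

namespace Summit.CriticalPhenomena.PercolationContinuityZ3.Theorems

open MeasureTheory Set Literature.Probability.LatticeModels Literature.Probability.Percolation
open scoped Classical BigOperators

/-- **One-cut bound with logarithmic loss (all `|A|`), unconditional.**
`P(1 ≤ N ∧ N < E N/2) ≤ (16·⌈log₂ |A|⌉ + 2)·t` whenever all pairwise disconnection probabilities among distinct
relays are `≤ t`. [cite: KozmaNitzan2024, Lemma 2 (p. 6); VandenbergHaggstromKahn2005, Thm. 1.3 — via the tree's hub lemmas] -/
theorem oneCut_logLoss :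
    ∀ (n : ℕ) (w : Sym2 (Fin n) → unitInterval) (A : Finset (Fin n)) (o : Fin n) (t : ℝ), 0 ≤ t →
      (∀ a ∈ A, ∀ a' ∈ A, a ≠ a' →
        (Literature.Probability.LatticeModels.prodBernoulli w).real
          (Literature.Probability.Percolation.openConn a a')ᶜ ≤ t) →
      (Literature.Probability.LatticeModels.prodBernoulli w).real
        {ω : Literature.Probability.Percolation.BondConfig (Fin n) |
          1 ≤ (A.filter fun a => ω ∈ Literature.Probability.Percolation.openConn o a).card ∧
          ((A.filter fun a => ω ∈ Literature.Probability.Percolation.openConn o a).card : ℝ) <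
            (∑ a ∈ A, (Literature.Probability.LatticeModels.prodBernoulli w).real
              (Literature.Probability.Percolation.openConn o a)) / 2} ≤
        (16 * (Nat.clog 2 A.card : ℝ) + 2) * t := by
  intro n w A o t ht hpair
  set μ := prodBernoulli w with hμ
  by_cases hA : A = ∅
  · have hempty : {ω : BondConfig (Fin n) | 1 ≤ (A.filter fun a => ω ∈ openConn o a).card ∧
        ((A.filter fun a => ω ∈ openConn o a).card : ℝ) <
          (∑ a ∈ A, μ.real (openConn o a)) / 2} = ∅ := by
      ext ω; simp [hA]
    rw [hempty, measureReal_empty]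
    positivity
  obtain ⟨a₀, ha₀⟩ := Finset.nonempty_iff_ne_empty.2 hA
  have hcard : 1 ≤ A.card := Finset.card_pos.2 ⟨a₀, ha₀⟩
  -- star budget at the hub `a₀`
  have hδ₀ : ∀ a ∈ A, μ.real (openConn a a₀)ᶜ ≤ t := by
    intro a ha
    by_cases haa : a = a₀
    · subst haa
      have : (openConn a a : Set (BondConfig (Fin n)))ᶜ = ∅ :=
        Set.compl_empty_iff.2 (Set.eq_univ_of_forall fun ω => SimpleGraph.Reachable.refl a)
      rw [this, measureReal_empty]; exact ht
    · exact hpair a ha a₀ ha₀ haa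
  have hEN : (∑ a ∈ A, μ.real (openConn o a)) ≤ (A.card : ℝ) := by
    calc (∑ a ∈ A, μ.real (openConn o a)) ≤ ∑ _a ∈ A, (1 : ℝ) :=
          Finset.sum_le_sum fun a _ => measureReal_le_one
      _ = (A.card : ℝ) := by simp
  have hENnn : 0 ≤ ∑ a ∈ A, μ.real (openConn o a) := Finset.sum_nonneg fun a _ => measureReal_nonneg
  -- part 1: `{o ↮ a₀}` — log-scale lower tail on `A.erase a₀`
  set E₁ : Set (BondConfig (Fin n)) := {ω | ω ∉ openConn o a₀ ∧
      1 ≤ ((A.erase a₀).filter fun a => ω ∈ openConn o a).card ∧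
      ((A.erase a₀).filter fun a => ω ∈ openConn o a).card < A.card} with hE₁
  have h1 : μ.real E₁ ≤ 16 * t * (Nat.clog 2 A.card : ℝ) :=
    nhlt_logScaleLowerTail n w A o a₀ t A.card ha₀ hδ₀
  -- part 2: `{o ↔ a₀}` — Markov for the hub block
  set E₂ : Set (BondConfig (Fin n)) := {ω | ω ∈ openConn o a₀ ∧
      ((A.filter fun a => ω ∈ openConn o a).card : ℝ) < (∑ a ∈ A, μ.real (openConn o a)) / 2}
    with hE₂
  have hthr : (∑ a ∈ A, μ.real (openConn o a)) / 2 < A.card := by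
    have : (0 : ℝ) < A.card := by exact_mod_cast hcard
    linarith
  have h2raw := nhlt_hubBlockMarkov n w A o a₀ ((∑ a ∈ A, μ.real (openConn o a)) / 2) hthr
  have h2 : μ.real E₂ ≤ 2 * t := by
    refine h2raw.trans ?_
    have hnum : (∑ a ∈ A, μ.real (openConn a a₀)ᶜ) ≤ A.card * t := by
      calc (∑ a ∈ A, μ.real (openConn a a₀)ᶜ) ≤ ∑ _a ∈ A, t := Finset.sum_le_sum hδ₀
        _ = A.card * t := by simp
    have hden : (A.card : ℝ) / 2 ≤ A.card - (∑ a ∈ A, μ.real (openConn o a)) / 2 := by linarith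
    have hpos : (0 : ℝ) < A.card / 2 := by
      have : (0 : ℝ) < A.card := by exact_mod_cast hcard
      linarith
    calc (∑ a ∈ A, μ.real (openConn a a₀)ᶜ) / (A.card - (∑ a ∈ A, μ.real (openConn o a)) / 2)
        ≤ (A.card * t) / (A.card / 2) := div_le_div₀ (by positivity) hnum hpos hden
      _ = 2 * t := by field_simp
  -- cover and conclude
  have hcover : {ω : BondConfig (Fin n) | 1 ≤ (A.filter fun a => ω ∈ openConn o a).card ∧
        ((A.filter fun a => ω ∈ openConn o a).card : ℝ) <
          (∑ a ∈ A, μ.real (openConn o a)) / 2} ⊆ E₁ ∪ E₂ := by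
    rintro ω ⟨hN1, hN2⟩
    by_cases ho : ω ∈ openConn o a₀
    · exact Or.inr ⟨ho, hN2⟩
    · left
      have hfilt : (A.filter fun a => ω ∈ openConn o a) = (A.erase a₀).filter fun a => ω ∈ openConn o a := by
        ext a
        simp only [Finset.mem_filter, Finset.mem_erase]
        constructor
        · rintro ⟨haA, hoa⟩
          exact ⟨⟨fun h => ho (h ▸ hoa), haA⟩, hoa⟩
        · rintro ⟨⟨_, haA⟩, hoa⟩
          exact ⟨haA, hoa⟩
      refine ⟨ho, by rw [← hfilt]; exact hN1, ?_⟩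
      rw [← hfilt]
      have hle : ((A.erase a₀).filter fun a => ω ∈ openConn o a).card ≤ (A.erase a₀).card :=
        Finset.card_filter_le _ _
      rw [← hfilt] at hle
      have : (A.erase a₀).card < A.card := Finset.card_erase_lt_of_mem ha₀
      omega
  calc μ.real _ ≤ μ.real (E₁ ∪ E₂) := measureReal_mono hcover
    _ ≤ μ.real E₁ + μ.real E₂ := measureReal_union_le _ _
    _ ≤ 16 * t * (Nat.clog 2 A.card : ℝ) + 2 * t := add_le_add h1 h2
    _ = (16 * (Nat.clog 2 A.card : ℝ) + 2) * t := by ring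

end Summit.CriticalPhenomena.PercolationContinuityZ3.Theorems

end
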